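import Literature.AnabelianGeometry.SemiGraphs.PSCTwoComponentAffinePointedEdges
import Literature.AnabelianGeometry.SemiGraphs.PSCTwoComponentAffineOrigin
import HarnessLib

/-!
# [CombGC] Prop. 1.2 (i), [IUTchI] Rmk. 1.2.3 (iv) (cuspidal), [CombGC] Thm. 1.6 (i) at two-component data pointed on both sides

Mochizuki, *A combinatorial version of the Grothendieck conjecture* [CombGC] §1: Prop. 1.2 (i) p. 8, Thm.
1.6 (i) p. 13; *Inter-universal Teichmüller theory I* [IUTchI] Rmk. 1.2.3 (iv) pp. 41–42
[cite: MochizukiCombGC2007, Thm 1.6(i) p.13] [cite: MochizukiCombGC2007, Prop 1.2(i) p.8]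
[cite: Mochizuki2012, IUTchI Rmk 1.2.3(iv) pp.41-42].  PROOF-ONLY assembly (abc-iut-f-164 gen 2; rows F-0459
`PSCDatum.OpenInterDeterminesComponentHolds`, F-1931 `PSCDatum.CuspidalEdgeLikeCharacterizationHolds`, F-0458
`PSCDatum.NumericallyCuspidalIffHolds`) extending `PSCTwoComponentAffineOrigin.lean` from "at least two
marked points on each component" to the data of TWO-COMPONENT AFFINE SHAPE POINTED ON BOTH SIDES: two
STABLE pointed components `C₀ ∪_ν C₁` (genera `g₀`, `g − g₀`; `r − s ≥ 1` resp. `s ≥ 1` marked points;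
`2g₀ + (r−s) ≥ 2`, `2(g−g₀) + s ≥ 2`) glued at one node, over a pro-`Σ` completion `ι : Γ_{g,r} → Π`
(shape hypotheses as in `PSCTwoComponentAffineShape.lean`).

* `verticialOpenInterDeterminesVertex_of_twoComponentAffine'`: the verticial case — the two-cusp character
  of a component with two marked points, or the handle character `a ↦ 1` of a component with one (it has
  positive genus); abc-iut-f-165's criterion `verticialOpenInterDeterminesVertex_of_characters`.
* `openInterDeterminesComponent_of_twoComponentAffine'`: [CombGC] Prop. 1.2 (i), all three cases (edge-like:
  `PSCTwoComponentAffinePointedEdges.lean`, Heisenberg quotients; unramified: unchanged).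
* `openInterDeterminesComponentHolds_of_twoComponentAffine'`, `numericallyCuspidalIffHolds_of_twoComponentAffine'`:
  F-0459 and F-0458 (with `Σ = {l}`) at every origin of such data (F-1931 there is
  `cuspidalEdgeLikeCharacterizationHolds_of_cuspidallyStandard`, vertex-free).
* `exists_twoComponentAffinePointedOrigin_thm16i_holds`: for a prime `l`, the origin of these data with
  `Σ = {l}` satisfies F-0459 ∧ F-1931 ∧ F-0458 and is INHABITED by the pro-`l` datum "ELLIPTIC TAIL WITH ONE
  MARKED POINT": `Γ_{1,3}` split as a genus-`1` component carrying one marked point glued to a genus-`0`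
  component carrying two (the stable reduction of a 3-pointed elliptic curve when two marked points
  collide) — a shape outside the earlier family, which needed two marked points on each side.

Instance forms at data of the shape of genuine two-component curves; consistency evidence for the typed
rows, not the printed theorems for all pointed stable curves.  Nothing here takes a side on [IUTchIII]
Cor. 3.12.
-/

noncomputable section

namespace Literature.AnabelianGeometry.SemiGraphs

open scoped Pointwise
open Literature.GroupTheory.CombinatorialGroupTheory
open SemiGraphOfAnabelioids (IsProSigmaCompletion)
open Multiplicative

universe u

namespace PSCDatum

open TwoComponentAffine

section Shape

variable {P : Type u} [Group P] [TopologicalSpace P] [IsTopologicalGroup P]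
variable [CompactSpace P] [T2Space P] [TotallyDisconnectedSpace P] {Sigma : Set ℕ} {g r : ℕ}

/-! ### Verticial case: one marked point allowed -/

omit [T2Space P] in
/-- **[CombGC] Prop. 1.2 (i), verticial case, at two-component affine shape pointed on both sides.**
For `v ≠ w`: if the component of `v` has two marked points, the cusp character of
`verticialOpenInterDeterminesVertex_of_twoComponentAffine`; otherwise it has positive genus and the handle
character `a ↦ 1` of that component kills `Π_w` (all cusps `↦ 0`, so the node loop `↦ 0`) and is `1` on
`ι(a) ∈ Π_v`. [cite: MochizukiCombGC2007, Prop 1.2(i) p.8] -/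
theorem verticialOpenInterDeterminesVertex_of_twoComponentAffine' (hne : Sigma.Nonempty)
    (hprime : ∀ p ∈ Sigma, p.Prime) (ι : PuncturedSurfaceGroup g r →* P)
    (hι : IsProSigmaCompletion Sigma ι) (G : PSCDatum P) {g₀ s : ℕ} (hg₀ : g₀ ≤ g)
    (hsr : s + 1 ≤ r) (hst₀ : 1 ≤ g₀ ∨ 2 ≤ r - s) (hst₁ : 1 ≤ g - g₀ ∨ 2 ≤ s)
    (v₀ v₁ : G.graph.V) (hV : ∀ w, w = v₀ ∨ w = v₁) (ε : PuncturedSurfaceGroup g r)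
    (hε : ε = ((List.finRange r).map fun j : Fin r =>
          if s ≤ (j : ℕ) then PuncturedSurfaceGroup.c (g := g) j else 1).prod *
        ((List.finRange g).map fun i : Fin g => if (i : ℕ) < g₀ then
          PuncturedSurfaceGroup.a (r := r) i * PuncturedSurfaceGroup.b i *
            (PuncturedSurfaceGroup.a i)⁻¹ * (PuncturedSurfaceGroup.b i)⁻¹ else 1).prod)
    (hV₀ : G.vertGp v₀ = ((Subgroup.closure {x : PuncturedSurfaceGroup g r |
        (∃ i : Fin g, (i : ℕ) < g₀ ∧ (x = PuncturedSurfaceGroup.a i ∨ x = PuncturedSurfaceGroup.b i)) ∨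
        ∃ j : Fin r, s ≤ (j : ℕ) ∧ x = PuncturedSurfaceGroup.c j}).map ι).topologicalClosure)
    (hV₁ : G.vertGp v₁ = ((Subgroup.closure {x : PuncturedSurfaceGroup g r |
        (∃ i : Fin g, g₀ ≤ (i : ℕ) ∧ (x = PuncturedSurfaceGroup.a i ∨ x = PuncturedSurfaceGroup.b i)) ∨
        (∃ j : Fin r, (j : ℕ) < s ∧ x = PuncturedSurfaceGroup.c j) ∨ x = ε}).map ι).topologicalClosure) :
    G.VerticialOpenInterDeterminesVertex := by
  classical
  by_cases h2 : 2 ≤ s ∧ 2 ≤ r - s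
  · exact G.verticialOpenInterDeterminesVertex_of_twoComponentAffine hne hprime ι hι h2.1 (by omega)
      v₀ v₁ hV ε hε hV₀ hV₁
  obtain ⟨ℓ, hℓS⟩ := hne
  have hℓ : ℓ.Prime := hprime ℓ hℓS
  refine G.verticialOpenInterDeterminesVertex_of_characters hℓ.one_lt fun v w hvw => ?_
  -- a handle character on the side of `v` when available, else the two-cusp character
  have handle : ∀ (i₀ : Fin g) (m : ℕ), ∃ (φ : PuncturedSurfaceGroup g r →* Multiplicative (ZMod (ℓ ^ m)))
      (χ : P →* Multiplicative (ZMod (ℓ ^ m))), Continuous χ ∧ (∀ γ, χ (ι γ) = φ γ) ∧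
      φ (PuncturedSurfaceGroup.a i₀) = ofAdd 1 ∧ (∀ i, i ≠ i₀ → φ (PuncturedSurfaceGroup.a i) = 1) ∧
      (∀ i, φ (PuncturedSurfaceGroup.b i) = 1) ∧ (∀ k, φ (PuncturedSurfaceGroup.c k) = 1) ∧ φ ε = 1 := by
    intro i₀ m
    let wa : Fin g → ZMod (ℓ ^ m) := fun i => if i = i₀ then 1 else 0
    obtain ⟨φ, hφa, hφb, hφc⟩ :=
      PuncturedSurfaceGroup.exists_handleCuspCharacter (r := r) wa 0 0 (by simp)
    obtain ⟨χ, hχc, hχ⟩ := exists_continuous_extend_zmod_pow hι hℓ hℓS m φ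
    refine ⟨φ, χ, hχc, hχ, by rw [hφa]; simp [wa], fun i hi => by rw [hφa]; simp [wa, hi],
      fun i => by rw [hφb]; rfl, fun k => by rw [hφc]; rfl, ?_⟩
    rw [hε, character_nodeLoop φ hφc]; simp
  have cusps : ∀ (k₀ k₁ : Fin r) (m : ℕ), k₀ ≠ k₁ → (s ≤ (k₀ : ℕ) ↔ s ≤ (k₁ : ℕ)) →
      ∃ (φ : PuncturedSurfaceGroup g r →* Multiplicative (ZMod (ℓ ^ m)))
        (χ : P →* Multiplicative (ZMod (ℓ ^ m))), Continuous χ ∧ (∀ γ, χ (ι γ) = φ γ) ∧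
        φ (PuncturedSurfaceGroup.c k₀) = ofAdd 1 ∧ (∀ i, φ (PuncturedSurfaceGroup.a i) = 1) ∧
        (∀ i, φ (PuncturedSurfaceGroup.b i) = 1) ∧
        (∀ k, k ≠ k₀ → k ≠ k₁ → φ (PuncturedSurfaceGroup.c k) = 1) ∧ φ ε = 1 := by
    intro k₀ k₁ m hk hside
    let wc : Fin r → ZMod (ℓ ^ m) := fun l => (if l = k₀ then 1 else 0) + (if l = k₁ then -1 else 0)
    obtain ⟨φ, hφa, hφb, hφc⟩ :=
      PuncturedSurfaceGroup.exists_handleCuspCharacter (g := g) 0 0 wc (sum_twoDelta k₀ k₁)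
    obtain ⟨χ, hχc, hχ⟩ := exists_continuous_extend_zmod_pow hι hℓ hℓS m φ
    refine ⟨φ, χ, hχc, hχ, by rw [hφc]; simp [wc, hk], fun i => by rw [hφa]; rfl,
      fun i => by rw [hφb]; rfl, fun k h0 h1 => by rw [hφc]; simp [wc, h0, h1], ?_⟩
    rw [hε, character_nodeLoop φ hφc, sum_ite_twoDelta]
    by_cases h0 : s ≤ (k₀ : ℕ)
    · rw [if_pos h0, if_pos (hside.mp h0)]; simp
    · rw [if_neg h0, if_neg (fun h' => h0 (hside.mpr h'))]; simp
  rcases hV v with hv | hv <;> rcases hV w with hw | hw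
  · exact absurd (hv.trans hw.symm) hvw
  · -- `v = v₀`, `w = v₁`
    rw [hv, hw]
    by_cases hr : 2 ≤ r - s
    · refine ⟨ι (PuncturedSurfaceGroup.c ⟨s, by omega⟩), ?_, fun m => ?_⟩
      · rw [hV₀]
        exact Subgroup.le_topologicalClosure _ (Subgroup.mem_map_of_mem ι
          (Subgroup.subset_closure (Or.inr ⟨⟨s, by omega⟩, le_rfl, rfl⟩)))
      · obtain ⟨φ, χ, hχc, hχ, h1, ha, hb, hc, hφε⟩ := cusps ⟨s, by omega⟩ ⟨s + 1, by omega⟩ m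
          (fun h => by simp [Fin.ext_iff] at h) (by simp)
        refine ⟨χ, ?_, by rw [hχ, h1]⟩
        rw [hV₁]
        refine topologicalClosure_map_closure_le_ker ι χ hχc _ ?_
        rintro y (⟨i, -, (rfl | rfl)⟩ | ⟨j, hj', rfl⟩ | rfl)
        · rw [hχ, ha]
        · rw [hχ, hb]
        · rw [hχ, hc j (fun h => by simp [h] at hj') (fun h => by simp [h] at hj')]
        · rw [hχ, hφε]
    · have hg : 1 ≤ g₀ := hst₀.resolve_right hr
      refine ⟨ι (PuncturedSurfaceGroup.a ⟨0, by omega⟩), ?_, fun m => ?_⟩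
      · rw [hV₀]
        exact Subgroup.le_topologicalClosure _ (Subgroup.mem_map_of_mem ι
          (Subgroup.subset_closure (Or.inl ⟨⟨0, by omega⟩, by change 0 < g₀; omega, Or.inl rfl⟩)))
      · obtain ⟨φ, χ, hχc, hχ, h1, ha, hb, hc, hφε⟩ := handle ⟨0, by omega⟩ m
        refine ⟨χ, ?_, by rw [hχ, h1]⟩
        rw [hV₁]
        refine topologicalClosure_map_closure_le_ker ι χ hχc _ ?_
        rintro y (⟨i, hi, (rfl | rfl)⟩ | ⟨j, -, rfl⟩ | rfl)
        · rw [hχ, ha i (fun h => by simp [h] at hi; omega)]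
        · rw [hχ, hb]
        · rw [hχ, hc]
        · rw [hχ, hφε]
  · -- `v = v₁`, `w = v₀`
    rw [hv, hw]
    by_cases hr : 2 ≤ s
    · refine ⟨ι (PuncturedSurfaceGroup.c ⟨0, by omega⟩), ?_, fun m => ?_⟩
      · rw [hV₁]
        exact Subgroup.le_topologicalClosure _ (Subgroup.mem_map_of_mem ι
          (Subgroup.subset_closure (Or.inr (Or.inl ⟨⟨0, by omega⟩, by change 0 < s; omega, rfl⟩))))
      · obtain ⟨φ, χ, hχc, hχ, h1, ha, hb, hc, hφε⟩ := cusps ⟨0, by omega⟩ ⟨1, by omega⟩ m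
          (fun h => by simp [Fin.ext_iff] at h) (by simp; omega)
        refine ⟨χ, ?_, by rw [hχ, h1]⟩
        rw [hV₀]
        refine topologicalClosure_map_closure_le_ker ι χ hχc _ ?_
        rintro y (⟨i, -, (rfl | rfl)⟩ | ⟨j, hj', rfl⟩)
        · rw [hχ, ha]
        · rw [hχ, hb]
        · rw [hχ, hc j (fun h => by simp [h] at hj'; omega) (fun h => by simp [h] at hj'; omega)]
    · have hg : 1 ≤ g - g₀ := hst₁.resolve_right hr
      refine ⟨ι (PuncturedSurfaceGroup.a ⟨g₀, by omega⟩), ?_, fun m => ?_⟩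
      · rw [hV₁]
        exact Subgroup.le_topologicalClosure _ (Subgroup.mem_map_of_mem ι
          (Subgroup.subset_closure (Or.inl ⟨⟨g₀, by omega⟩, by change g₀ ≤ g₀; exact le_rfl,
            Or.inl rfl⟩)))
      · obtain ⟨φ, χ, hχc, hχ, h1, ha, hb, hc, hφε⟩ := handle ⟨g₀, by omega⟩ m
        refine ⟨χ, ?_, by rw [hχ, h1]⟩
        rw [hV₀]
        refine topologicalClosure_map_closure_le_ker ι χ hχc _ ?_
        rintro y (⟨i, hi, (rfl | rfl)⟩ | ⟨j, -, rfl⟩)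
        · rw [hχ, ha i (fun h => by simp [h] at hi)]
        · rw [hχ, hb]
        · rw [hχ, hc]
  · exact absurd (hv.trans hw.symm) hvw


/-! ### All three cases -/

/-- **[CombGC] Prop. 1.2 (i) — all three cases — at every datum of two-component affine shape pointed on
both sides** (each component stable with at least one marked point; the unramified case for sturdy data).
[cite: MochizukiCombGC2007, Prop 1.2(i) p.8] -/
theorem openInterDeterminesComponent_of_twoComponentAffine' (hne : Sigma.Nonempty)
    (hprime : ∀ p ∈ Sigma, p.Prime) (ι : PuncturedSurfaceGroup g r →* P)
    (hι : IsProSigmaCompletion Sigma ι) (G : PSCDatum P) {g₀ s : ℕ} (hg₀ : g₀ ≤ g) (hs : 1 ≤ s)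
    (hsr : s + 1 ≤ r) (hst₀ : 1 ≤ g₀ ∨ 2 ≤ r - s) (hst₁ : 1 ≤ g - g₀ ∨ 2 ≤ s) (e : G.graph.C ≃ Fin r)
    (hC : ∀ c, G.cuspGp c =
      ((PuncturedSurfaceGroup.cuspInertia (g := g) (e c)).map ι).topologicalClosure)
    (v₀ v₁ : G.graph.V) (hV : ∀ w, w = v₀ ∨ w = v₁) (ε : PuncturedSurfaceGroup g r)
    (hε : ε = ((List.finRange r).map fun j : Fin r =>
            if s ≤ (j : ℕ) then PuncturedSurfaceGroup.c (g := g) j else 1).prod *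
          ((List.finRange g).map fun i : Fin g => if (i : ℕ) < g₀ then
            PuncturedSurfaceGroup.a (r := r) i * PuncturedSurfaceGroup.b i *
              (PuncturedSurfaceGroup.a i)⁻¹ * (PuncturedSurfaceGroup.b i)⁻¹ else 1).prod)
    (hV₀ : G.vertGp v₀ = ((Subgroup.closure {x : PuncturedSurfaceGroup g r |
            (∃ i : Fin g, (i : ℕ) < g₀ ∧ (x = PuncturedSurfaceGroup.a i ∨ x = PuncturedSurfaceGroup.b i)) ∨
            ∃ j : Fin r, s ≤ (j : ℕ) ∧ x = PuncturedSurfaceGroup.c j}).map ι).topologicalClosure)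
    (hV₁ : G.vertGp v₁ = ((Subgroup.closure {x : PuncturedSurfaceGroup g r |
            (∃ i : Fin g, g₀ ≤ (i : ℕ) ∧ (x = PuncturedSurfaceGroup.a i ∨ x = PuncturedSurfaceGroup.b i)) ∨
            (∃ j : Fin r, (j : ℕ) < s ∧ x = PuncturedSurfaceGroup.c j) ∨ x = ε}).map ι).topologicalClosure)
    (n₀ : G.graph.N) (hN : ∀ n, n = n₀)
    (hE : G.nodeGp n₀ = ((Subgroup.zpowers ε).map ι).topologicalClosure)
    (hgen₀ : G.genus v₀ = g₀) (hgen₁ : G.genus v₁ = g - g₀) :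
    G.VerticialOpenInterDeterminesVertex ∧ G.EdgeLikeOpenInterDeterminesEdge ∧
      G.UnrVerticialOpenInterDeterminesVertex :=
  ⟨G.verticialOpenInterDeterminesVertex_of_twoComponentAffine' hne hprime ι hι hg₀ hsr hst₀ hst₁ v₀ v₁
      hV ε hε hV₀ hV₁,
    G.edgeLikeOpenInterDeterminesEdge_of_twoComponentAffine' hne hprime ι hι hg₀ hs hsr hst₀ hst₁ e hC ε
      hε n₀ hN hE,
    G.unrVerticialOpenInterDeterminesVertex_of_twoComponentAffine hne hprime ι hι hg₀ e hC v₀ v₁ hV ε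
      hε hV₀ hV₁ n₀ hN hE hgen₀ hgen₁⟩

end Shape

/-! ### F-0459 and F-0458 at origins of two-component data pointed on both sides -/

section Origin

variable (Ω : PSCOrigin.{u}) (l : ℕ)

/-- **F-0459 / [CombGC] Prop. 1.2 (i) at every origin whose data are of two-component affine shape
pointed on both sides** (profinite `Π`). [cite: MochizukiCombGC2007, Prop 1.2(i) p.8] -/
theorem openInterDeterminesComponentHolds_of_twoComponentAffine'
    (hΩ : ∀ ⦃Q : Type u⦄ [Group Q] [TopologicalSpace Q] [IsTopologicalGroup Q] (G : PSCDatum Q),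
      Ω.IsOfPSCType G → CompactSpace Q ∧ T2Space Q ∧ TotallyDisconnectedSpace Q ∧
        ∃ (S : Set ℕ) (g r g₀ s : ℕ) (ι : PuncturedSurfaceGroup g r →* Q) (e : G.graph.C ≃ Fin r)
          (v₀ v₁ : G.graph.V) (n₀ : G.graph.N) (ε : PuncturedSurfaceGroup g r),
          S.Nonempty ∧ (∀ p ∈ S, p.Prime) ∧ IsProSigmaCompletion S ι ∧ g₀ ≤ g ∧ 1 ≤ s ∧ s + 1 ≤ r ∧
          (1 ≤ g₀ ∨ 2 ≤ r - s) ∧ (1 ≤ g - g₀ ∨ 2 ≤ s) ∧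
          (∀ c, G.cuspGp c =
            ((PuncturedSurfaceGroup.cuspInertia (g := g) (e c)).map ι).topologicalClosure) ∧
          (∀ w, w = v₀ ∨ w = v₁) ∧ (∀ n, n = n₀) ∧
          ε = ((List.finRange r).map fun j : Fin r =>
            if s ≤ (j : ℕ) then PuncturedSurfaceGroup.c (g := g) j else 1).prod *
          ((List.finRange g).map fun i : Fin g => if (i : ℕ) < g₀ then
            PuncturedSurfaceGroup.a (r := r) i * PuncturedSurfaceGroup.b i *
              (PuncturedSurfaceGroup.a i)⁻¹ * (PuncturedSurfaceGroup.b i)⁻¹ else 1).prod ∧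
          G.vertGp v₀ = ((Subgroup.closure {x : PuncturedSurfaceGroup g r |
            (∃ i : Fin g, (i : ℕ) < g₀ ∧ (x = PuncturedSurfaceGroup.a i ∨ x = PuncturedSurfaceGroup.b i)) ∨
            ∃ j : Fin r, s ≤ (j : ℕ) ∧ x = PuncturedSurfaceGroup.c j}).map ι).topologicalClosure ∧
          G.vertGp v₁ = ((Subgroup.closure {x : PuncturedSurfaceGroup g r |
            (∃ i : Fin g, g₀ ≤ (i : ℕ) ∧ (x = PuncturedSurfaceGroup.a i ∨ x = PuncturedSurfaceGroup.b i)) ∨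
            (∃ j : Fin r, (j : ℕ) < s ∧ x = PuncturedSurfaceGroup.c j) ∨ x = ε}).map ι).topologicalClosure ∧
          G.nodeGp n₀ = ((Subgroup.zpowers ε).map ι).topologicalClosure ∧
          G.genus v₀ = g₀ ∧ G.genus v₁ = g - g₀) :
    OpenInterDeterminesComponentHolds Ω := by
  intro Q _ _ _ G hG
  obtain ⟨hc, ht, hd, S, g, r, g₀, s, ι, e, v₀, v₁, n₀, ε, hne, hprime, hι, hg₀, hs, hsr, hst₀, hst₁, hC,
    hV, hN, hε, hV₀, hV₁, hE, hgen₀, hgen₁⟩ := hΩ G hG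
  exact G.openInterDeterminesComponent_of_twoComponentAffine' hne hprime ι hι hg₀ hs hsr hst₀ hst₁ e hC
    v₀ v₁ hV ε hε hV₀ hV₁ n₀ hN hE hgen₀ hgen₁

/-- **F-0458 / [CombGC] Thm. 1.6 (i) as printed at every origin whose data are of two-component affine
shape pointed on both sides, `Σ = {l}`** — by abc-iut-f-164's reduction
`numericallyCuspidalIffHolds_of_characterization` from F-0459 (above) and F-1931
(`cuspidalEdgeLikeCharacterizationHolds_of_cuspidallyStandard`; `(g, r)` is hyperbolic by stability of the
two components). [cite: MochizukiCombGC2007, Thm 1.6(i) p.13] -/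
theorem numericallyCuspidalIffHolds_of_twoComponentAffine'
    (hΩ : ∀ ⦃Q : Type u⦄ [Group Q] [TopologicalSpace Q] [IsTopologicalGroup Q] (G : PSCDatum Q),
      Ω.IsOfPSCType G → CompactSpace Q ∧ T2Space Q ∧ TotallyDisconnectedSpace Q ∧
        ∃ (S : Set ℕ) (g r g₀ s : ℕ) (ι : PuncturedSurfaceGroup g r →* Q) (e : G.graph.C ≃ Fin r)
          (v₀ v₁ : G.graph.V) (n₀ : G.graph.N) (ε : PuncturedSurfaceGroup g r),
          S.Nonempty ∧ (∀ p ∈ S, p.Prime) ∧ IsProSigmaCompletion S ι ∧ g₀ ≤ g ∧ 1 ≤ s ∧ s + 1 ≤ r ∧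
          (1 ≤ g₀ ∨ 2 ≤ r - s) ∧ (1 ≤ g - g₀ ∨ 2 ≤ s) ∧
          (∀ c, G.cuspGp c =
            ((PuncturedSurfaceGroup.cuspInertia (g := g) (e c)).map ι).topologicalClosure) ∧
          (∀ w, w = v₀ ∨ w = v₁) ∧ (∀ n, n = n₀) ∧
          ε = ((List.finRange r).map fun j : Fin r =>
            if s ≤ (j : ℕ) then PuncturedSurfaceGroup.c (g := g) j else 1).prod *
          ((List.finRange g).map fun i : Fin g => if (i : ℕ) < g₀ then
            PuncturedSurfaceGroup.a (r := r) i * PuncturedSurfaceGroup.b i *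
              (PuncturedSurfaceGroup.a i)⁻¹ * (PuncturedSurfaceGroup.b i)⁻¹ else 1).prod ∧
          G.vertGp v₀ = ((Subgroup.closure {x : PuncturedSurfaceGroup g r |
            (∃ i : Fin g, (i : ℕ) < g₀ ∧ (x = PuncturedSurfaceGroup.a i ∨ x = PuncturedSurfaceGroup.b i)) ∨
            ∃ j : Fin r, s ≤ (j : ℕ) ∧ x = PuncturedSurfaceGroup.c j}).map ι).topologicalClosure ∧
          G.vertGp v₁ = ((Subgroup.closure {x : PuncturedSurfaceGroup g r |
            (∃ i : Fin g, g₀ ≤ (i : ℕ) ∧ (x = PuncturedSurfaceGroup.a i ∨ x = PuncturedSurfaceGroup.b i)) ∨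
            (∃ j : Fin r, (j : ℕ) < s ∧ x = PuncturedSurfaceGroup.c j) ∨ x = ε}).map ι).topologicalClosure ∧
          G.nodeGp n₀ = ((Subgroup.zpowers ε).map ι).topologicalClosure ∧
          G.genus v₀ = g₀ ∧ G.genus v₁ = g - g₀)
    (hSig : ∀ ⦃Q : Type u⦄ [Group Q] [TopologicalSpace Q] [IsTopologicalGroup Q] (G : PSCDatum Q),
      Ω.IsOfPSCType G → G.Sigma = {l}) :
    NumericallyCuspidalIffHolds Ω :=
  numericallyCuspidalIffHolds_of_characterization Ω l
    (fun _ _ _ _ G hG => ⟨(hΩ G hG).1, (hΩ G hG).2.2.1⟩) hSig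
    (openInterDeterminesComponentHolds_of_twoComponentAffine' Ω hΩ)
    (cuspidalEdgeLikeCharacterizationHolds_of_cuspidallyStandard Ω fun Q _ _ _ G hG => by
      obtain ⟨hc, ht, hd, S, g, r, g₀, s, ι, e, v₀, v₁, n₀, ε, hne, hprime, hι, hg₀, hs, hsr, hst₀, hst₁,
        hC, -⟩ := hΩ G hG
      exact ⟨hc, ht, hd, S, g, r, ι, e, hne, hprime,
        by unfold PuncturedSurfaceGroup.IsHyperbolicType; omega, hι, hC⟩)

end Origin

/-! ### The origin with `Σ = {l}`, inhabited by the elliptic tail with one marked point -/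

/-- **At the origin of two-component affine data pointed on both sides with `Σ = {l}` — inhabited by the
pro-`l` datum "genus-1 component with ONE marked point glued to a genus-0 component with two"
(`Γ_{1,3}`, `g₀ = 1`, `s = 2`) — F-0459, F-1931 and F-0458 all HOLD.**  Instance forms at data of the
shape of genuine two-component curves (each component stable with at least one marked point), not the
printed theorems for all pointed stable curves.
[cite: MochizukiCombGC2007, Thm 1.6(i) p.13] [cite: MochizukiCombGC2007, Prop 1.2(i) p.8]
[cite: Mochizuki2012, IUTchI Rmk 1.2.3(iv) pp.41-42] -/
theorem exists_twoComponentAffinePointedOrigin_thm16i_holds (l : ℕ) (hl : l.Prime) :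
    ∃ Ω : PSCOrigin.{0},
      (∃ (Q : ProfiniteGrp.{0}) (ι : PuncturedSurfaceGroup 1 3 →* Q) (G : PSCDatum Q)
        (e : G.graph.C ≃ Fin 3) (v₀ v₁ : G.graph.V),
        IsProSigmaCompletion {l} ι ∧ Ω.IsOfPSCType G ∧ G.Sigma = {l} ∧ G.graph.i = 2 ∧ G.graph.n = 1 ∧
          G.graph.r = 3 ∧ (∀ w, w = v₀ ∨ w = v₁) ∧ G.genus v₀ = 1 ∧ G.genus v₁ = 0 ∧
          (∀ c, G.graph.cuspEnd c = v₁ ↔ ((e c : Fin 3) : ℕ) < 2) ∧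
          ∀ c, G.cuspGp c =
            ((PuncturedSurfaceGroup.cuspInertia (g := 1) (e c)).map ι).topologicalClosure) ∧
      OpenInterDeterminesComponentHolds Ω ∧ CuspidalEdgeLikeCharacterizationHolds Ω ∧
      NumericallyCuspidalIffHolds Ω := by
  classical
  let Ω : PSCOrigin.{0} :=
    ⟨fun {Q} _ _ G => ∃ (_ : IsTopologicalGroup Q), G.Sigma = {l} ∧
      (CompactSpace Q ∧ T2Space Q ∧ TotallyDisconnectedSpace Q ∧
        ∃ (S : Set ℕ) (g r g₀ s : ℕ) (ι : PuncturedSurfaceGroup g r →* Q) (e : G.graph.C ≃ Fin r)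
          (v₀ v₁ : G.graph.V) (n₀ : G.graph.N) (ε : PuncturedSurfaceGroup g r),
          S.Nonempty ∧ (∀ p ∈ S, p.Prime) ∧ IsProSigmaCompletion S ι ∧ g₀ ≤ g ∧ 1 ≤ s ∧ s + 1 ≤ r ∧
          (1 ≤ g₀ ∨ 2 ≤ r - s) ∧ (1 ≤ g - g₀ ∨ 2 ≤ s) ∧
          (∀ c, G.cuspGp c =
            ((PuncturedSurfaceGroup.cuspInertia (g := g) (e c)).map ι).topologicalClosure) ∧
          (∀ w, w = v₀ ∨ w = v₁) ∧ (∀ n, n = n₀) ∧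
          ε = ((List.finRange r).map fun j : Fin r =>
            if s ≤ (j : ℕ) then PuncturedSurfaceGroup.c (g := g) j else 1).prod *
          ((List.finRange g).map fun i : Fin g => if (i : ℕ) < g₀ then
            PuncturedSurfaceGroup.a (r := r) i * PuncturedSurfaceGroup.b i *
              (PuncturedSurfaceGroup.a i)⁻¹ * (PuncturedSurfaceGroup.b i)⁻¹ else 1).prod ∧
          G.vertGp v₀ = ((Subgroup.closure {x : PuncturedSurfaceGroup g r |
            (∃ i : Fin g, (i : ℕ) < g₀ ∧ (x = PuncturedSurfaceGroup.a i ∨ x = PuncturedSurfaceGroup.b i)) ∨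
            ∃ j : Fin r, s ≤ (j : ℕ) ∧ x = PuncturedSurfaceGroup.c j}).map ι).topologicalClosure ∧
          G.vertGp v₁ = ((Subgroup.closure {x : PuncturedSurfaceGroup g r |
            (∃ i : Fin g, g₀ ≤ (i : ℕ) ∧ (x = PuncturedSurfaceGroup.a i ∨ x = PuncturedSurfaceGroup.b i)) ∨
            (∃ j : Fin r, (j : ℕ) < s ∧ x = PuncturedSurfaceGroup.c j) ∨ x = ε}).map ι).topologicalClosure ∧
          G.nodeGp n₀ = ((Subgroup.zpowers ε).map ι).topologicalClosure ∧
          G.genus v₀ = g₀ ∧ G.genus v₁ = g - g₀)⟩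
  have hΩ : ∀ ⦃Q : Type⦄ [Group Q] [TopologicalSpace Q] [IsTopologicalGroup Q] (G : PSCDatum Q),
      Ω.IsOfPSCType G → CompactSpace Q ∧ T2Space Q ∧ TotallyDisconnectedSpace Q ∧
        ∃ (S : Set ℕ) (g r g₀ s : ℕ) (ι : PuncturedSurfaceGroup g r →* Q) (e : G.graph.C ≃ Fin r)
          (v₀ v₁ : G.graph.V) (n₀ : G.graph.N) (ε : PuncturedSurfaceGroup g r),
          S.Nonempty ∧ (∀ p ∈ S, p.Prime) ∧ IsProSigmaCompletion S ι ∧ g₀ ≤ g ∧ 1 ≤ s ∧ s + 1 ≤ r ∧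
          (1 ≤ g₀ ∨ 2 ≤ r - s) ∧ (1 ≤ g - g₀ ∨ 2 ≤ s) ∧
          (∀ c, G.cuspGp c =
            ((PuncturedSurfaceGroup.cuspInertia (g := g) (e c)).map ι).topologicalClosure) ∧
          (∀ w, w = v₀ ∨ w = v₁) ∧ (∀ n, n = n₀) ∧
          ε = ((List.finRange r).map fun j : Fin r =>
            if s ≤ (j : ℕ) then PuncturedSurfaceGroup.c (g := g) j else 1).prod *
          ((List.finRange g).map fun i : Fin g => if (i : ℕ) < g₀ then
            PuncturedSurfaceGroup.a (r := r) i * PuncturedSurfaceGroup.b i *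
              (PuncturedSurfaceGroup.a i)⁻¹ * (PuncturedSurfaceGroup.b i)⁻¹ else 1).prod ∧
          G.vertGp v₀ = ((Subgroup.closure {x : PuncturedSurfaceGroup g r |
            (∃ i : Fin g, (i : ℕ) < g₀ ∧ (x = PuncturedSurfaceGroup.a i ∨ x = PuncturedSurfaceGroup.b i)) ∨
            ∃ j : Fin r, s ≤ (j : ℕ) ∧ x = PuncturedSurfaceGroup.c j}).map ι).topologicalClosure ∧
          G.vertGp v₁ = ((Subgroup.closure {x : PuncturedSurfaceGroup g r |
            (∃ i : Fin g, g₀ ≤ (i : ℕ) ∧ (x = PuncturedSurfaceGroup.a i ∨ x = PuncturedSurfaceGroup.b i)) ∨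
            (∃ j : Fin r, (j : ℕ) < s ∧ x = PuncturedSurfaceGroup.c j) ∨ x = ε}).map ι).topologicalClosure ∧
          G.nodeGp n₀ = ((Subgroup.zpowers ε).map ι).topologicalClosure ∧
          G.genus v₀ = g₀ ∧ G.genus v₁ = g - g₀ :=
    fun Q _ _ _ G hG => hG.2.2
  have hSig : ∀ ⦃Q : Type⦄ [Group Q] [TopologicalSpace Q] [IsTopologicalGroup Q] (G : PSCDatum Q),
      Ω.IsOfPSCType G → G.Sigma = {l} := fun Q _ _ _ G hG => hG.2.1
  have hl' : ∀ p ∈ ({l} : Set ℕ), p.Prime := fun p hp => by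
    rw [Set.mem_singleton_iff.mp hp]; exact hl
  refine ⟨Ω, ?_, openInterDeterminesComponentHolds_of_twoComponentAffine' Ω hΩ,
    cuspidalEdgeLikeCharacterizationHolds_of_cuspidallyStandard Ω (fun Q _ _ _ G hG => ?_),
    numericallyCuspidalIffHolds_of_twoComponentAffine' Ω l hΩ hSig⟩
  · obtain ⟨Q, ι, G, e, v₀, v₁, n₀, ε, hι, hS, hi, hn, hr, hC, hV, hN, hε, hV₀, hV₁, hE, hgen₀, hgen₁,
      -, hce⟩ := exists_twoComponentAffineDatum {l} ⟨l, rfl⟩ hl' 1 3 1 2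
    have hG : Ω.IsOfPSCType G := ⟨inferInstance, hS, inferInstance, inferInstance, inferInstance, {l}, 1, 3,
      1, 2, ι, e, v₀, v₁, n₀, ε, ⟨l, rfl⟩, hl', hι, le_rfl, by norm_num, le_rfl, Or.inl le_rfl,
      Or.inr le_rfl, hC, hV, hN, hε, hV₀, hV₁, hE, hgen₀, hgen₁⟩
    exact ⟨Q, ι, G, e, v₀, v₁, hι, hG, hS, hi, hn, hr, hV, hgen₀, hgen₁, hce, hC⟩
  · obtain ⟨hc, ht, hd, S, g, r, g₀, s, ι, e, v₀, v₁, n₀, ε, hne, hprime, hι, hg₀, hs, hsr, hst₀, hst₁, hC,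
      -⟩ := hΩ G hG
    exact ⟨hc, ht, hd, S, g, r, ι, e, hne, hprime,
      by unfold PuncturedSurfaceGroup.IsHyperbolicType; omega, hι, hC⟩

end PSCDatum

end Literature.AnabelianGeometry.SemiGraphs

end
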